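import Summits.BirchSwinnertonDyer.Rank1Residual.Additive.GoodModelNoLocalConditionDescent
import Summits.BirchSwinnertonDyer.Rank1Residual.Additive.PotSupersingularTprimeThreeNotCotorsion
import Summits.BirchSwinnertonDyer.Rank1Residual.Additive.GoodModelWildThree
import HarnessLib

/-!
# `H¹((K_∞)_η, E)(p) = 0` at a potentially good SUPERSINGULAR prime with a PRIME-TO-`p` level —
# WITHOUT the divisibility record: the local Coates–Greenberg statement on the TAME cell `(t′)` of
# O5 modulo A254 only (row T-CG-W addendum A2, cell `b2b-bsdres`, team n1011; seat n1011-p05 GEN 10)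

HONEST FRAMING (cell `b2b-bsdres`, run/shared/lean/b2b/bsd-rank1-residual/, verbatim in every
file): the goal of the cell is to DELETE the COMBINATION-SHAPED residual classes of the
Birch–Swinnerton-Dyer formula for ALL analytic-rank `≤ 1` elliptic curves over `ℚ` — "full BSD
formula for every rank `≤ 1` curve in class `C`" assembled STRICTLY from published theorems — so
that the rank-`≤ 1` remainder becomes exactly the CONSTRUCTION-SHAPED classes, which are TYPED
(missing-input `Prop`s), NOT attempted. This is not "finishing BSD". Team n1011 / classes O5–O6 of
RESIDUAL-MAP §I (potentially supersingular additive `p`): research route; TOOL theorems of Galois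
cohomology; 0 definitions, 0 NEW named facts (the Coates–Greenberg record A254
`CoatesGreenberg1996.H1_goodModelKernel_trivial` is carried as `hCG`, never dropped; NO
divisibility record here); nothing booked, no mark moves, closes no pair.

## What

Addendum A1 (`PotSupersingularLocalH1Vanishing`) proved the printed local statement
"`H¹(F_∞,w, E)(p) = 0` at a potentially supersingular `v`" (Coates, LNM 1716 §3, from [CoGr]
Props. 4.3/4.8) for ARBITRARY semistability defect modulo A254 AND the divisibility record CD
(`cd_p = 1`). When the good supersingular model is fixed by a level of index PRIME TO `p` — the
TAME situation of T-CG-SS — CD is not needed: the coprime-index descent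
`Descent.exists_eq_smul_sub_of_coprime_of_level` (F3a, `gcd([G : N], p^{k'}) = 1`) replaces the
divisible one. This file records that CD-free local statement:

* §1 (generic number field `K`, `κ` cyclotomic, `v ∋ p`): `eq_zero_of_pow_nsmul_eq_zero_of_forall_cocycle`
  — the DÉVISSAGE once torsion-valued cocycles on `(ker κ)_v` are principal; then, for a good
  model `W₀ = C • E ⊗ K̄_v` all of
  whose `p`-power torsion reduces to `Õ`, an open normal `U ≤ Γ_K` with `p ∤ [Γ_K : U]` whose local
  elements fix `C`): `finite_quotient_localSubgroup_of_index_coprime` /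
  `coprime_card_quotient_localSubgroup_of_index_coprime` (`[G : G ∩ U_v] ∣ [Γ_K : U]` for
  `G = (ker κ)_v`, via `G/(G ∩ U_v) ↪ Γ_K/U`), `exists_eq_smul_sub_of_pow_smul_eq_zero_of_coprime_level`
  (torsion-valued cocycles on `(ker κ)_v` are principal, mod `hCG` only) and
  **`eq_zero_of_pow_nsmul_eq_zero_of_torsion_mem_kernel_of_coprime_level`**:
  `H¹((K_∞)_η, E(K̄_v))` has no non-zero class killed by a power of `p` (dévissage as in A1);
  `eq_zero_of_pow_nsmul_eq_zero_of_goodSupersingular` — the case of GOOD SUPERSINGULAR reduction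
  at `v` over any number field (minimal model, `U = ⊤`): Greenberg's original
  "`Im(κ_K) = H¹(K, E[p^∞])`", as the local group statement, mod A254 only.
* §2 (`E/ℚ`, the cell `(t′)` of O5: `Addv ∧ SubTprime`, Kodaira III/III* at `3`, `e ∈ {3,4,6}`,
  `e ∤ p − 1` at `p ≥ 5`): `eq_zero_of_pow_nsmul_eq_zero_of_subTprime` (`p ≥ 5`; A2b's Kummer model
  and prime-to-`p` level `exists_normal_isOpen_coprime_smul_eq_of_pow_eq`),
  `eq_zero_of_pow_nsmul_eq_zero_of_subTprime_three` (`p = 3`; A3a/A3b's Kummer–Tate model and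
  quartic level) — **`H¹((ℚ_∞)_η, E)(p) = 0` on `(t′)` modulo A254 only.**

NOT included: the cell `(G) ∧ ss` = `SubGss` of O5 (there S2 argues through the quadratic twist
`V` with GOOD supersingular reduction and a global twist transport, not through a good model of `E`
in the format of §1); its local form would follow from §1 with `W₀` = the minimal model of `V` and
`C` = the twisting change of variables over `ℚ_v(√p*)` — left to a consumer's request.

References: J. Coates, LNM 1716 §3 (proof of Lemma 3.5); R. Greenberg, LNM 1716 §2
[GreenbergLNM1716]; J. Coates, R. Greenberg, Invent. Math. 124 (1996) §4 Props. 4.3, 4.8, Cor. 3.2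
[CoatesGreenberg1996]; J.-P. Serre, *Galois Cohomology* I.§2.4 [SerreGaloisCohomology1997];
skeleton `cells/n1011/skel/T-CG-W.md`.
-/

noncomputable section

open scoped Classical NNReal

open WeierstrassCurve

universe u

namespace Summit.BirchSwinnertonDyer.Rank1Residual.Additive.GoodModelLine

open NumberField IsDedekindDomain Field IsDedekindDomain.HeightOneSpectrum
  Literature.NumberTheory.GaloisRepresentations Literature.NumberTheory.EllipticCurves
  Summit.BirchSwinnertonDyer.Rank1Residual.X2.GreenbergVatsalReductionDatum
  Summit.BirchSwinnertonDyer.Rank1Residual.X2.GreenbergVatsalSelmerLink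
  Summit.BirchSwinnertonDyer.Rank1Residual.GaloisImage
  Literature.NumberTheory.EllipticCurves.CoatesGreenberg1996
  Literature.NumberTheory.EllipticCurves.Rank1Residual

/-! ## §1 The coprime-level local vanishing — generic number field -/

section Generic

variable {K : Type} [Field K] [NumberField K] (W : WeierstrassCurve K) [W.IsElliptic] (p : ℕ)
  [hp : Fact p.Prime] {v : HeightOneSpectrum (𝓞 K)}
  {w : Valuation (AlgebraicClosure (v.adicCompletion K)) ℝ≥0}
  (hw : ∀ x, (w x : ℝ) =
    spectralNorm (v.adicCompletion K) (AlgebraicClosure (v.adicCompletion K)) x)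
  {C : VariableChange (AlgebraicClosure (v.adicCompletion K))}
  {W₀ : WeierstrassCurve w.integer}
  (hW₀ : C • (W.baseChange (v.adicCompletion K)).baseChange (AlgebraicClosure (v.adicCompletion K)) =
    W₀.baseChange (AlgebraicClosure (v.adicCompletion K)))
  (hΔ : IsUnit W₀.Δ)
  (htors : ∀ P : localPoints W (v.adicCompletion K), (∃ k : ℕ, p ^ k • P = 0) →
    Affine.Point.congrEquiv hW₀ (VariableChange.pointEquiv _ C
      (Affine.Point.congrEquiv (baseChange_baseChange_adicCompletion W v).symm P)) ∈
      kernelOfReduction W₀ (Valuation.integer.integers w))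

/-- **Dévissage: `H¹((K_∞)_η, E(K̄_v))(p) = 0` once torsion-valued cocycles are principal**
(generic: any number field, any elliptic `W`, the local group `(ker κ)_v` of any `ℤ_p`-extension):
if every continuous crossed homomorphism `(ker κ)_v → E(K̄_v)` with `p`-power-torsion values is
principal, then `H¹((ker κ)_v, E(K̄_v))` has no non-zero class killed by a power of `p`.
Greenberg's deduction (LNM 1716 §2, "just as in the case of Kummer theory for the multiplicative
group"): `p[φ] = 0 ⇒ pφ = ∂a`, `a = p b` (`E(K̄_v)` is divisible, `nsmul_surjective_localPoints`),
and `φ − ∂b` takes `p`-torsion values; induction on the exponent.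
[cite: GreenbergLNM1716, §2 (potentially supersingular paragraph)] -/
theorem eq_zero_of_pow_nsmul_eq_zero_of_forall_cocycle (κ : ZpExtension K p)
    (hprin : ∀ F : contOneCocycles (discreteTopRep (localSubgroup κ.kerSubgroup (v.adicCompletion K))
      (localPoints W (v.adicCompletion K))), (∀ τ, ∃ k : ℕ, p ^ k • F.1 τ = 0) →
      ∃ a : localPoints W (v.adicCompletion K),
        ∀ τ : localSubgroup κ.kerSubgroup (v.adicCompletion K), F.1 τ = τ • a - a)
    (z : discreteH1 (localSubgroup κ.kerSubgroup (v.adicCompletion K))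
      (localPoints W (v.adicCompletion K))) (k : ℕ) (hz : p ^ k • z = 0) : z = 0 := by
  have hcont : ∀ m : localPoints W (v.adicCompletion K),
      Continuous fun g : localSubgroup κ.kerSubgroup (v.adicCompletion K) ↦ g • m := fun m ↦
    (continuous_smul_localPoints W (v.adicCompletion K) m).comp continuous_subtype_val
  have h1 : ∀ z : discreteH1 (localSubgroup κ.kerSubgroup (v.adicCompletion K))
      (localPoints W (v.adicCompletion K)), p • z = 0 → z = 0 := by
    intro z hz
    obtain ⟨φ, rfl⟩ := oneCocycleClass_surjective _ z
    have hn : oneCocycleClass (discreteTopRep (localSubgroup κ.kerSubgroup (v.adicCompletion K))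
        (localPoints W (v.adicCompletion K))) (p • φ) = 0 := by
      rw [← hz]; exact map_nsmul (oneCocycleClassₗ _) p φ
    obtain ⟨a, ha⟩ := (oneCocycleClass_eq_zero_iff _ _).mp hn
    obtain ⟨b, rfl⟩ := W.nsmul_surjective_localPoints (v.adicCompletion K) hp.out.ne_zero a
    have hψ : ∀ g, ∃ k : ℕ, p ^ k • (φ - coboundaryCocycle b (hcont b)).1 g = 0 := by
      intro g
      refine ⟨1, ?_⟩
      have h := ha g
      rw [cocycle_nsmul_apply] at h
      change p • φ.1 g = g • ((fun P : localPoints W (v.adicCompletion K) ↦ p • P) b) -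
        (fun P : localPoints W (v.adicCompletion K) ↦ p • P) b at h
      rw [pow_one, cocycle_sub_apply, coboundaryCocycle_apply, smul_sub, h, smul_sub,
        smul_comm (g : localSubgroup κ.kerSubgroup (v.adicCompletion K)) p b, sub_self]
    obtain ⟨c, hc⟩ := hprin _ hψ
    have hψ0 : oneCocycleClass (discreteTopRep (localSubgroup κ.kerSubgroup (v.adicCompletion K))
        (localPoints W (v.adicCompletion K))) (φ - coboundaryCocycle b (hcont b)) = 0 :=
      (oneCocycleClass_eq_zero_iff _ _).mpr ⟨c, hc⟩
    rwa [oneCocycleClass_sub, oneCocycleClass_coboundaryCocycle, sub_zero] at hψ0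
  induction k generalizing z with
  | zero => rwa [pow_zero, one_smul] at hz
  | succ k ih =>
    rw [pow_succ, ← smul_smul] at hz
    exact h1 z (ih _ hz)

omit hp in
/-- **`[G : G ∩ U_v]` divides `[Γ_K : U]`** (`G ≤ Γ_{K_v}` any subgroup, `U ⊴ Γ_K`): the
restriction `Γ_{K_v} → Γ_K` induces an injection `G/(G ∩ U_v) ↪ Γ_K/U`. [folklore] -/
theorem card_quotient_localSubgroup_dvd_index (G : Subgroup (absoluteGaloisGroup (v.adicCompletion K)))
    (U : Subgroup (absoluteGaloisGroup K)) [U.Normal] :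
    Nat.card (G ⧸ (localSubgroup U (v.adicCompletion K)).subgroupOf G) ∣ U.index := by
  set f : G →* absoluteGaloisGroup K ⧸ U :=
    (QuotientGroup.mk' U).comp (((resGal (K := K) (v.adicCompletion K) :
      absoluteGaloisGroup (v.adicCompletion K) →ₜ* absoluteGaloisGroup K) :
      absoluteGaloisGroup (v.adicCompletion K) →* absoluteGaloisGroup K).comp G.subtype) with hf
  have hker : f.ker = (localSubgroup U (v.adicCompletion K)).subgroupOf G := by
    ext g
    rw [MonoidHom.mem_ker, Subgroup.mem_subgroupOf, mem_localSubgroup_iff, hf, MonoidHom.comp_apply,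
      MonoidHom.comp_apply, QuotientGroup.mk'_apply, QuotientGroup.eq_one_iff]
    rfl
  rw [← hker, Nat.card_congr (QuotientGroup.quotientKerEquivRange f).toEquiv, Subgroup.index]
  exact Subgroup.card_subgroup_dvd_card f.range

omit hp in
/-- For `U` of index prime to `p` (hence of finite index), `G/(G ∩ U_v)` is finite. [folklore] -/
theorem finite_quotient_localSubgroup_of_index_coprime
    (G : Subgroup (absoluteGaloisGroup (v.adicCompletion K))) (U : Subgroup (absoluteGaloisGroup K))
    [U.Normal] (hp1 : p ≠ 1) (hcop : U.index.Coprime p) :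
    Finite (G ⧸ (localSubgroup U (v.adicCompletion K)).subgroupOf G) := by
  have hU0 : U.index ≠ 0 := fun h0 ↦ hp1 (by rw [h0, Nat.coprime_zero_left] at hcop; exact hcop)
  have hd := card_quotient_localSubgroup_dvd_index (v := v) G U
  exact Nat.finite_of_card_ne_zero (fun h0 ↦ hU0 (Nat.eq_zero_of_zero_dvd (h0 ▸ hd)))

omit hp in
/-- For `U` of index prime to `p`, `[G : G ∩ U_v]` is prime to `p`. [folklore] -/
theorem coprime_card_quotient_localSubgroup_of_index_coprime
    (G : Subgroup (absoluteGaloisGroup (v.adicCompletion K))) (U : Subgroup (absoluteGaloisGroup K))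
    [U.Normal] (hcop : U.index.Coprime p) :
    (Nat.card (G ⧸ (localSubgroup U (v.adicCompletion K)).subgroupOf G)).Coprime p :=
  Nat.Coprime.coprime_dvd_left (card_quotient_localSubgroup_dvd_index (v := v) G U) hcop

include hw hΔ htors in
/-- **Torsion-valued cocycles on `(ker κ)_v` are principal when a PRIME-TO-`p` level fixes the good
supersingular model** (mod the Coates–Greenberg record only — NO divisibility record): for `κ`
cyclotomic, `v ∋ p`, `W₀ = C • E ⊗ K̄_v` a good model all of whose `p`-power torsion reduces to
`Õ`, and an open normal `U ≤ Γ_K` with `p ∤ [Γ_K : U]` whose local elements fix `C`, every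
continuous crossed homomorphism `(ker κ)_v → E(K̄_v)` with `p`-power-torsion values is principal —
F3a's COPRIME-INDEX descent `Descent.exists_eq_smul_sub_of_coprime_of_level` on the finite-index
subgroup `G ∩ U_v` (`[G : G ∩ U_v] ∣ [Γ_K : U]`), the level supplied by F3b's local core
`exists_eq_smul_sub_of_pow_smul_eq_zero_of_level`.
[cite: GreenbergLNM1716, §2 (potentially supersingular paragraph)] [cite: CoatesGreenberg1996, Cor. 3.2 and §4 Props. 4.3, 4.8 (through Coates, LNM 1716 §3)] -/
theorem exists_eq_smul_sub_of_pow_smul_eq_zero_of_coprime_level (hCG : H1_goodModelKernel_trivial.{0})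
    (κ : ZpExtension K p) (hκ : κ.IsCyclotomic) (hpv : ((p : ℕ) : 𝓞 K) ∈ v.asIdeal)
    (U : Subgroup (absoluteGaloisGroup K)) [U.Normal] (hUo : IsOpen (U : Set (absoluteGaloisGroup K)))
    (hcop : U.index.Coprime p)
    (hUC : ∀ σ : absoluteGaloisGroup (v.adicCompletion K),
      absGaloisRestrict K (v.adicCompletion K) σ ∈ U →
        C.map ((absoluteGaloisGroup.toAlgEquiv (v.adicCompletion K) σ :
          AlgebraicClosure (v.adicCompletion K) ≃ₐ[v.adicCompletion K]
            AlgebraicClosure (v.adicCompletion K)) :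
          AlgebraicClosure (v.adicCompletion K) →+* AlgebraicClosure (v.adicCompletion K)) = C)
    (F : contOneCocycles (discreteTopRep (localSubgroup κ.kerSubgroup (v.adicCompletion K))
      (localPoints W (v.adicCompletion K))))
    (hF : ∀ τ, ∃ k : ℕ, p ^ k • F.1 τ = 0) :
    ∃ a : localPoints W (v.adicCompletion K),
      ∀ τ : localSubgroup κ.kerSubgroup (v.adicCompletion K), F.1 τ = τ • a - a := by
  haveI : CompactSpace (absoluteGaloisGroup (v.adicCompletion K)) :=
    absoluteGaloisGroup_compactSpace (v.adicCompletion K)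
  have hGc : IsClosed (localSubgroup κ.kerSubgroup (v.adicCompletion K) :
      Set (absoluteGaloisGroup (v.adicCompletion K))) :=
    κ.isClosed_kerSubgroup.preimage (map_continuous (resGal (K := K) (v.adicCompletion K)))
  haveI : CompactSpace (localSubgroup κ.kerSubgroup (v.adicCompletion K)) :=
    isCompact_iff_compactSpace.mp hGc.isCompact
  have hOc : IsClosed (localSubgroup U (v.adicCompletion K) :
      Set (absoluteGaloisGroup (v.adicCompletion K))) :=
    (U.isClosed_of_isOpen hUo).preimage (map_continuous (resGal (K := K) (v.adicCompletion K)))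
  haveI := finite_quotient_localSubgroup_of_index_coprime (v := v) p
    (localSubgroup κ.kerSubgroup (v.adicCompletion K)) U hp.out.one_lt.ne' hcop
  have hUO : (localSubgroup κ.kerSubgroup (v.adicCompletion K) ⊓ localSubgroup U (v.adicCompletion K) :
      Subgroup (absoluteGaloisGroup (v.adicCompletion K))) ≤
        localSubgroup κ.kerSubgroup (v.adicCompletion K) := inf_le_left
  refine Descent.exists_eq_smul_sub_of_coprime_of_level
    ((localSubgroup U (v.adicCompletion K)).subgroupOf (localSubgroup κ.kerSubgroup (v.adicCompletion K)))
    (coprime_card_quotient_localSubgroup_of_index_coprime (v := v) p _ U hcop)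
    (fun F' hF' ↦ ?_) F hF
  obtain ⟨a₁, ha₁⟩ := exists_eq_smul_sub_of_pow_smul_eq_zero_of_level W p hw hW₀ hΔ htors hCG κ
    hκ hpv (localSubgroup κ.kerSubgroup (v.adicCompletion K) ⊓ localSubgroup U (v.adicCompletion K))
    (hGc.inter hOc) inf_le_left
    (fun σ hσ ↦ hUC σ ((mem_localSubgroup_iff U (v.adicCompletion K) σ).mp (Subgroup.mem_inf.mp hσ).2))
    (contOneCocycles.pullback (subgroupInclusion hUO)
      (resHomOfEquivariant (subgroupInclusion hUO) (AddMonoidHom.id _) fun _ _ ↦ rfl) F')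
    (fun τ ↦ by
      obtain ⟨k, hk⟩ := hF' (Subgroup.inclusion hUO τ)
      exact ⟨k, hk⟩)
  refine ⟨a₁, fun g hg ↦ ?_⟩
  have hg' : (g : absoluteGaloisGroup (v.adicCompletion K)) ∈
      localSubgroup κ.kerSubgroup (v.adicCompletion K) ⊓ localSubgroup U (v.adicCompletion K) :=
    Subgroup.mem_inf.mpr ⟨g.2, Subgroup.mem_subgroupOf.mp hg⟩
  exact ha₁ ⟨g, hg'⟩

include hw hΔ htors in
/-- **`H¹((K_∞)_η, E(K̄_v))(p) = 0` at a potentially good SUPERSINGULAR prime with a PRIME-TO-`p`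
model-fixing level, modulo the Coates–Greenberg record ONLY** (no divisibility / `cd_p` input):
for `κ` cyclotomic, `v ∋ p`, `W₀ = C • E ⊗ K̄_v` a good model swallowing all `p`-power torsion, and
an open normal `U ≤ Γ_K` of index prime to `p` whose local elements fix `C`, the group
`H¹((ker κ)_v, E(K̄_v))` has no non-zero class killed by a power of `p`. Dévissage as in A1
(`pφ = ∂a`, `a = pb` by `nsmul_surjective_localPoints`, `φ − ∂b` torsion-valued ⇒ principal by
`exists_eq_smul_sub_of_pow_smul_eq_zero_of_coprime_level`). The TAME counterpart of A1's
`eq_zero_of_pow_nsmul_eq_zero_of_torsion_mem_kernel_of_divisible`; the printed statement is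
[CoGr] Props. 4.3/4.8 as quoted by Coates, LNM 1716 §3 ("`D = 0` if and only if `E` has potential
supersingular reduction at `v`").
[cite: CoatesGreenberg1996, §4 Props. 4.3, 4.8 (through Coates, LNM 1716 §3, proof of Lemma 3.5) and Cor. 3.2] [cite: GreenbergLNM1716, §2 (potentially supersingular paragraph)] -/
theorem eq_zero_of_pow_nsmul_eq_zero_of_torsion_mem_kernel_of_coprime_level
    (hCG : H1_goodModelKernel_trivial.{0}) (κ : ZpExtension K p) (hκ : κ.IsCyclotomic)
    (hpv : ((p : ℕ) : 𝓞 K) ∈ v.asIdeal)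
    (U : Subgroup (absoluteGaloisGroup K)) [U.Normal] (hUo : IsOpen (U : Set (absoluteGaloisGroup K)))
    (hcop : U.index.Coprime p)
    (hUC : ∀ σ : absoluteGaloisGroup (v.adicCompletion K),
      absGaloisRestrict K (v.adicCompletion K) σ ∈ U →
        C.map ((absoluteGaloisGroup.toAlgEquiv (v.adicCompletion K) σ :
          AlgebraicClosure (v.adicCompletion K) ≃ₐ[v.adicCompletion K]
            AlgebraicClosure (v.adicCompletion K)) :
          AlgebraicClosure (v.adicCompletion K) →+* AlgebraicClosure (v.adicCompletion K)) = C)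
    (z : discreteH1 (localSubgroup κ.kerSubgroup (v.adicCompletion K))
      (localPoints W (v.adicCompletion K))) (k : ℕ) (hz : p ^ k • z = 0) : z = 0 :=
  eq_zero_of_pow_nsmul_eq_zero_of_forall_cocycle W p κ
    (fun F hF ↦ exists_eq_smul_sub_of_pow_smul_eq_zero_of_coprime_level W p hw hW₀ hΔ htors hCG κ
      hκ hpv U hUo hcop hUC F hF) z k hz

/-- **`H¹((K_∞)_η, E(K̄_v))(p) = 0` for a curve with GOOD SUPERSINGULAR reduction at `v ∣ p`, over
ANY number field, modulo the Coates–Greenberg record ONLY** — Greenberg's original statement (LNM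
1716 §2: "`C_v = E[p^∞]` since `Ẽ[p^∞] = 0`. Thus the result is that `Im(κ_K) = H¹(K, E[p^∞])`",
`K ⊇ (F_∞)_η`): §1 with the `K_v`-rational minimal model (`localSpectralModel`, fixed by all of
`Γ_{K_v}`; all `p`-power torsion in its kernel of reduction by
`mem_localKernelOfReduction_of_pow_nsmul_eq_zero`) and the trivial level `U = ⊤`. The tree's
`localKerOver_kerSubgroup_eq_top_of_supersingular` is the global-class form (mod (I2)); this is the
local group itself. [cite: GreenbergLNM1716, §2 (good supersingular primes: C_v = E[p^∞], Im κ = H¹)] [cite: CoatesGreenberg1996, Cor. 3.2] -/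
theorem eq_zero_of_pow_nsmul_eq_zero_of_goodSupersingular (hCG : H1_goodModelKernel_trivial.{0})
    (κ : ZpExtension K p) (hκ : κ.IsCyclotomic) (hpv : ((p : ℕ) : 𝓞 K) ∈ v.asIdeal)
    (hgood : W.HasGoodReductionAt v) (hss : ¬ W.HasUnitRootAt v)
    (z : discreteH1 (localSubgroup κ.kerSubgroup (v.adicCompletion K))
      (localPoints W (v.adicCompletion K))) (k : ℕ) (hz : p ^ k • z = 0) : z = 0 := by
  have hW₀ : (((W.baseChange (v.adicCompletion K)).exists_isMinimal (v.adicCompletionIntegers K)).choose.map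
        (algebraMap (v.adicCompletion K) (AlgebraicClosure (v.adicCompletion K)))) •
      (W.baseChange (v.adicCompletion K)).baseChange (AlgebraicClosure (v.adicCompletion K)) =
      (W.localSpectralModel v).baseChange (AlgebraicClosure (v.adicCompletion K)) := by
    rw [← VariableChange.baseChange_smul_eq, W.smul_baseChange_eq_map_localMinimalIntegralModel v,
      W.localSpectralModel_baseChange v]
  have htors : ∀ P : localPoints W (v.adicCompletion K), (∃ k : ℕ, p ^ k • P = 0) →
      Affine.Point.congrEquiv hW₀ (VariableChange.pointEquiv _
        (((W.baseChange (v.adicCompletion K)).exists_isMinimal (v.adicCompletionIntegers K)).choose.map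
          (algebraMap (v.adicCompletion K) (AlgebraicClosure (v.adicCompletion K))))
        (Affine.Point.congrEquiv (baseChange_baseChange_adicCompletion W v).symm P)) ∈
        kernelOfReduction (W.localSpectralModel v) (Valuation.integer.integers v.spectralValuation) := by
    rintro P ⟨k, hk⟩
    have hmem := mem_localKernelOfReduction_of_pow_nsmul_eq_zero p W hpv hgood hss hk
    rw [localKernelOfReduction, AddSubgroup.mem_comap] at hmem
    change W.localPointsEquivSpectralModel v P ∈ _ at hmem
    rwa [localPointsEquivSpectralModel_eq_transport W v P hW₀] at hmem
  have hUC : ∀ σ : absoluteGaloisGroup (v.adicCompletion K),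
      absGaloisRestrict K (v.adicCompletion K) σ ∈ (⊤ : Subgroup (absoluteGaloisGroup K)) →
      (((W.baseChange (v.adicCompletion K)).exists_isMinimal (v.adicCompletionIntegers K)).choose.map
        (algebraMap (v.adicCompletion K) (AlgebraicClosure (v.adicCompletion K)))).map
        ((absoluteGaloisGroup.toAlgEquiv (v.adicCompletion K) σ :
          AlgebraicClosure (v.adicCompletion K) ≃ₐ[v.adicCompletion K]
            AlgebraicClosure (v.adicCompletion K)) :
          AlgebraicClosure (v.adicCompletion K) →+* AlgebraicClosure (v.adicCompletion K)) =
      ((W.baseChange (v.adicCompletion K)).exists_isMinimal (v.adicCompletionIntegers K)).choose.map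
        (algebraMap (v.adicCompletion K) (AlgebraicClosure (v.adicCompletion K))) := by
    intro σ _
    rw [VariableChange.map_map]
    congr 1
    ext x
    exact AlgEquiv.commutes _ x
  exact eq_zero_of_pow_nsmul_eq_zero_of_torsion_mem_kernel_of_coprime_level W p
    (coe_spectralValuation v) hW₀ (W.isUnit_Δ_localSpectralModel hgood) htors hCG κ hκ hpv ⊤
    isOpen_univ (by rw [Subgroup.index_top]; exact Nat.coprime_one_left p) hUC z k hz

end Generic

/-! ## §2 The cell `(t′)` of O5 (`E/ℚ`) -/

section Tprime

variable (W : WeierstrassCurve ℚ) [W.IsElliptic] [W.IsGloballyMinimal] (p : ℕ) [hp : Fact p.Prime]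
  {v : HeightOneSpectrum (𝓞 ℚ)}

/-- **`H¹((ℚ_∞)_η, E)(p) = 0` on the cell `(t′)` of O5, `p ≥ 5`, modulo A254 ONLY**: for `E/ℚ`
additive at `p ≥ 5` with `SubTprime W p` (`e ∈ {3,4,6}`, `e ∤ p − 1`: potentially good
SUPERSINGULAR over the tame Kummer field), `H¹((ker κ)_v, E(K̄_v))` has no non-zero class killed by
a power of `p` — A2b's Kummer good model (`exists_kummerGoodModel_global`, supersingular residue
`forall_goodReductionHom_eq_zero_of_pow_smul_eq_zero_of_not_dvd`) with its prime-to-`p` normal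
level (`exists_normal_isOpen_coprime_smul_eq_of_pow_eq`), fed to §1.
[cite: CoatesGreenberg1996, §4 Props. 4.3, 4.8 (through Coates, LNM 1716 §3) and Cor. 3.2] [cite: GreenbergLNM1716, §2] -/
theorem eq_zero_of_pow_nsmul_eq_zero_of_subTprime (hCG : H1_goodModelKernel_trivial.{0})
    (hp5 : 5 ≤ p) (hadd : Addv W p) (h : SubTprime W p) (κ : ZpExtension ℚ p) (hκ : κ.IsCyclotomic)
    (hpv : ((p : ℕ) : 𝓞 ℚ) ∈ v.asIdeal)
    (z : discreteH1 (localSubgroup κ.kerSubgroup (v.adicCompletion ℚ))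
      (localPoints W (v.adicCompletion ℚ))) (k : ℕ) (hz : p ^ k • z = 0) : z = 0 := by
  have hj : 0 ≤ padicValRat p W.j := not_lt.mp h.1
  obtain ⟨θ, C, W₀, hθ, hW₀, hΔ, -, hfix, -⟩ := exists_kummerGoodModel_global p W hp5 hpv hj
  have htors : ∀ P : localPoints W (v.adicCompletion ℚ), (∃ k : ℕ, p ^ k • P = 0) →
      Affine.Point.congrEquiv hW₀ (VariableChange.pointEquiv _ C
        (Affine.Point.congrEquiv (baseChange_baseChange_adicCompletion W v).symm P)) ∈
        kernelOfReduction W₀ (Valuation.integer.integers (specVal v)) := by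
    rintro P ⟨k, hk⟩
    have hk0 : p ^ k •
        (show (W.baseChange (AlgebraicClosure (v.adicCompletion ℚ))).toAffine.Point from P) = 0 := hk
    refine (mem_kernelOfReduction_iff _).mpr ((goodReductionHom_eq_zero_iff _ hΔ _).mp
      (forall_goodReductionHom_eq_zero_of_pow_smul_eq_zero_of_not_dvd W p hp5 hpv hadd hj h.2.2
        hW₀ hΔ _ (n := k) ?_))
    rw [← map_nsmul, ← map_nsmul, ← map_nsmul, hk0, map_zero, map_zero, map_zero]
  obtain ⟨U, hUn, hUo, hUi, hUθ⟩ := exists_normal_isOpen_coprime_smul_eq_of_pow_eq p hp5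
    (semistabilityIndex_dvd_twelve W p) hθ
  haveI := hUn
  exact eq_zero_of_pow_nsmul_eq_zero_of_torsion_mem_kernel_of_coprime_level W p (specVal_spec v) hW₀
    hΔ htors hCG κ hκ hpv U hUo hUi (fun σ hσ ↦ hfix σ
      (smul_absClosureEmbedding_eq_of_absGaloisRestrict_mem ℚ (v.adicCompletion ℚ) hUθ σ hσ)) z k hz

/-- **`H¹((ℚ_∞)_η, E)(3) = 0` on the cell `(t′)` of O5 at `p = 3` (Kodaira III / III*), modulo A254
ONLY**: A3a's Kummer–Tate good model (`SubTprime.exists_kummerGoodModel_global_three`, residue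
`c̃₄ = 0`, supersingular: `goodReductionHom_eq_zero_of_pow_smul_eq_zero_of_residue_c₄_eq_zero_three`)
with A3b's quartic prime-to-`3` level (`exists_normal_isOpen_coprime_three_smul_eq_of_pow_four_eq_three`),
fed to §1. [cite: CoatesGreenberg1996, §4 Props. 4.3, 4.8 (through Coates, LNM 1716 §3) and Cor. 3.2] [cite: GreenbergLNM1716, §2] -/
theorem eq_zero_of_pow_nsmul_eq_zero_of_subTprime_three [Fact (Nat.Prime 3)]
    (hCG : H1_goodModelKernel_trivial.{0}) (hadd : Addv W 3) (h : SubTprime W 3)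
    (κ : ZpExtension ℚ 3) (hκ : κ.IsCyclotomic) (hpv : ((3 : ℕ) : 𝓞 ℚ) ∈ v.asIdeal)
    (z : discreteH1 (localSubgroup κ.kerSubgroup (v.adicCompletion ℚ))
      (localPoints W (v.adicCompletion ℚ))) (k : ℕ) (hz : 3 ^ k • z = 0) : z = 0 := by
  obtain ⟨θ, C, W₀, hW₀, hΔ, hθ, hfix, hc₄⟩ :=
    SubTprime.exists_kummerGoodModel_global_three W hadd h hpv
  have htors := forall_mem_kernelOfReduction_of_residue_c₄_eq_zero_three W hpv hW₀ hΔ hc₄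
  have hθ4 : θ ^ 4 = 3 := by rw [hθ]; norm_num
  obtain ⟨U, hUn, hUo, hUi, hUθ⟩ := exists_normal_isOpen_coprime_three_smul_eq_of_pow_four_eq_three hθ4
  haveI := hUn
  exact eq_zero_of_pow_nsmul_eq_zero_of_torsion_mem_kernel_of_coprime_level W 3 (specVal_spec v) hW₀
    hΔ htors hCG κ hκ hpv U hUo hUi (fun σ hσ ↦ hfix σ
      (smul_absClosureEmbedding_eq_of_absGaloisRestrict_mem ℚ (v.adicCompletion ℚ) hUθ σ hσ)) z k hz

end Tprime

end Summit.BirchSwinnertonDyer.Rank1Residual.Additive.GoodModelLine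

end
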